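import Mathlib.Combinatorics.SimpleGraph.Basic
import Mathlib.Algebra.BigOperators.Ring.Finset
import Mathlib.Data.Fintype.BigOperators
import HarnessLib

/-!
# Tensor networks in sum-of-products form: value and primal graph

A (closed) **tensor network** in the sense of Markov–Shi (*Simulating quantum computation by
contracting tensor networks*, §3, Def. 3.1–3.3: "a rank-`k` tensor … is an `m^k`-dimensional
array of complex numbers indexed by `k` indices, each of which takes `m` values"; "a tensor
network is a collection of tensors, each index of which may be used by either one or two
tensors"; contracting all shared indices of a closed network yields a rank-`0` tensor, and "the
result does not depend on the order of contractions") is presented here in the order-free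
**sum-of-products** form: a finite set of variables (the indices) ranging over a finite domain,
a finite set of factors (the tensors), each with a scope (the indices it carries) and an entry
function depending only on the values of the variables in its scope; the **value** of the
network — the number obtained by contracting everything — is
`Σ_{assignments a} ∏_{factors f} entry f a`.

We do not impose Markov–Shi's "each index is used by at most two tensors": allowing an index to
be shared by several factors (a factor graph) changes nothing below and is convenient (an
equality tensor is then implicit); `TensorNetwork.IsBinary` records their condition.

* `TensorNetwork R Var Dom Factor` — scopes `scope : Factor → Finset Var`, entries
  `entry : Factor → (Var → Dom) → R` with the locality axiom `entry_congr`.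
* `TensorNetwork.value` — `Σ_a ∏_f entry f a` (the full contraction).
* `TensorNetwork.primalGraph` — two variables adjacent iff some factor carries both (for a
  network in Markov–Shi's sense this is the line graph `G*` of the network's graph `G`, whose
  treewidth governs the cost of contraction, their Prop. 4.2 / Thm. 4.6).
* `TensorNetwork.IsBinary` — every variable lies in the scope of at most two factors;
  `TensorNetwork.IsClosed` — exactly two (no open wires: then `value` is the full contraction).
* sanity: `value_eq_zero_of_entry_eq_zero`, `value_of_isEmpty_factor`.

## References

* [MarkovShi2008] I. L. Markov, Y. Shi, SIAM J. Comput. 38 (2008) 963–981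
  (arXiv:quant-ph/0511069), §3 (Def. 3.1–3.3, eq. (1), Prop. 3.5), §4 (the line graph `G*`).
  Read via `lit read paper:arxiv-quant-ph_0511069` (pp. 7–9).
* R. Dechter, *Bucket elimination: a unifying framework for reasoning*, Artif. Intell. 113
  (1999) 41–85 (sum-of-products evaluation over a primal graph; cited by Markov–Shi, §1).
-/

namespace Literature.LinearAlgebra.TensorNetworks

open Finset

/-- A **tensor network in sum-of-products form** over the commutative semiring `R`: variables
`Var` (indices) with common finite domain `Dom`, factors `Factor` (tensors) with scopes and
entries, the entry of a factor depending only on the values of the variables in its scope.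
Markov–Shi's tensor networks (Def. 3.3) are the networks in which every variable lies in at
most two scopes (`IsBinary`). [cite: MarkovShi2008, §3 (Def 3.1–3.3)] -/
structure TensorNetwork (R : Type*) [CommSemiring R] (Var Dom Factor : Type*) where
  /-- The indices carried by a tensor. -/
  scope : Factor → Finset Var
  /-- The entries of a tensor, read off a global assignment of values to indices. -/
  entry : Factor → (Var → Dom) → R
  /-- An entry depends only on the indices in the tensor's scope. -/
  entry_congr : ∀ (f : Factor) ⦃a b : Var → Dom⦄, (∀ v ∈ scope f, a v = b v) → entry f a = entry f b

namespace TensorNetwork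

variable {R : Type*} [CommSemiring R] {Var Dom Factor : Type*}

/-- The **value** (full contraction) of a closed tensor network: the sum over all assignments of
the product of all entries, `Σ_a ∏_f entry f a` — the rank-`0` tensor obtained by contracting
every index (Markov–Shi, §3: "a tensor network with `k` open wires can be contracted to a single
tensor of rank `k`, and the result does not depend on the order of contractions"; eq. (1) is the
case of one contraction step). [cite: MarkovShi2008, §3 (Def 3.3 and eq. (1))] -/
def value [Fintype Var] [DecidableEq Var] [Fintype Dom] [Fintype Factor]
    (N : TensorNetwork R Var Dom Factor) : R :=
  ∑ a : Var → Dom, ∏ f, N.entry f a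

/-- The **primal graph** of a network: two distinct variables are adjacent iff some factor
carries both. For a network in Markov–Shi's sense (every index on at most two tensors, the
network drawn as a graph `G` with tensors as vertices and indices as edges) this is the line
graph `G*`. [cite: MarkovShi2008, §4 (the line graph G*, Prop 4.2)] -/
def primalGraph (N : TensorNetwork R Var Dom Factor) : SimpleGraph Var :=
  SimpleGraph.fromRel fun u v => ∃ f, u ∈ N.scope f ∧ v ∈ N.scope f

/-- Adjacency in the primal graph. [cite: MarkovShi2008, §4 (the line graph G*)] -/
theorem primalGraph_adj (N : TensorNetwork R Var Dom Factor) (u v : Var) :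
    N.primalGraph.Adj u v ↔ u ≠ v ∧ ∃ f, u ∈ N.scope f ∧ v ∈ N.scope f := by
  rw [primalGraph, SimpleGraph.fromRel_adj]
  constructor
  · rintro ⟨hne, ⟨f, hu, hv⟩ | ⟨f, hv, hu⟩⟩ <;> exact ⟨hne, f, hu, hv⟩
  · rintro ⟨hne, f, hu, hv⟩; exact ⟨hne, Or.inl ⟨f, hu, hv⟩⟩

/-- Markov–Shi's condition: every index is used by at most two tensors ("each index of which
may be used by either one or two tensors", Def. 3.3; an index used by one tensor is an open
wire). Note that `value` sums over every index, so it is Markov–Shi's full contraction exactly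
for CLOSED networks (`IsClosed`: every index on exactly two tensors); an index on a single
tensor is traced out by `value`, and an index in no scope multiplies `value` by `|Dom|`.
[cite: MarkovShi2008, §3 (Def 3.3)] -/
def IsBinary [Fintype Factor] [DecidableEq Var] (N : TensorNetwork R Var Dom Factor) : Prop :=
  ∀ v : Var, (Finset.univ.filter fun f => v ∈ N.scope f).card ≤ 2

/-- A network is **closed** (no open wires) if every index is used by exactly two tensors; for
closed networks `value` is the rank-`0` tensor obtained by contracting every edge
(Markov–Shi, §3). [cite: MarkovShi2008, §3 (Def 3.3 and Prop 3.5)] -/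
def IsClosed [Fintype Factor] [DecidableEq Var] (N : TensorNetwork R Var Dom Factor) : Prop :=
  ∀ v : Var, (Finset.univ.filter fun f => v ∈ N.scope f).card = 2

/-- Closed networks satisfy Markov–Shi's multiplicity condition. [folklore] -/
theorem IsClosed.isBinary [Fintype Factor] [DecidableEq Var] {N : TensorNetwork R Var Dom Factor}
    (h : N.IsClosed) : N.IsBinary :=
  fun v => (h v).le

/-- A network one of whose tensors vanishes identically has value `0`. [folklore] -/
theorem value_eq_zero_of_entry_eq_zero [Fintype Var] [DecidableEq Var] [Fintype Dom]
    [Fintype Factor] (N : TensorNetwork R Var Dom Factor) {f : Factor} (hf : ∀ a, N.entry f a = 0) :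
    N.value = 0 :=
  Finset.sum_eq_zero fun a _ => Finset.prod_eq_zero (Finset.mem_univ f) (hf a)

/-- A network without tensors has value `|Dom|^|Var|` (every assignment contributes the empty
product `1`). [folklore] -/
theorem value_of_isEmpty_factor [Fintype Var] [DecidableEq Var] [Fintype Dom] [Fintype Factor]
    [IsEmpty Factor] (N : TensorNetwork R Var Dom Factor) :
    N.value = (Fintype.card Dom ^ Fintype.card Var : ℕ) := by
  simp [value]

end TensorNetwork

end Literature.LinearAlgebra.TensorNetworks
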